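import Literature.Geometry.GeometricMeasureTheory.RectifiableImagePieceBasis
import Literature.Geometry.GeometricMeasureTheory.MassComplete
import HarnessLib

/-!
# Rectifiability from positive lower density and approximate tangent planes (cone criterion)

Support file for the proof of the named fact
`Literature.Geometry.GeometricMeasureTheory.Federer1969_compactness_integralCurrents` along
B. White's structure-theorem-free proof of the closure theorem, Step 4 of [White1989, p. 220]
("`P` is the approximate tangent plane of `M` at `a` … hence `M` is rectifiable";
[Bandara2006, proof of Thm. 4.2.1, p. 45, via Simon 11.8]). We follow the proof of
[Maggi2012, Thm. 10.8 (rectifiability from convergence of the blow-ups), Step one, with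
Prop. 10.9 (rectifiability criterion)], in the following measure-theoretic form, for an arbitrary
measure `σ` on a finite-dimensional inner product space `V`:

*if for `σ`-a.e. `a` there is a `(k+1)`-plane `W_a` with*
* positive lower density: `c · r^{k+1} ≤ σ(𝐁(a, r))` for small `r`, some `c > 0`, and
* the cone property: `r^{-(k+1)} σ(𝐁(a, r) ∖ (a + K(W_a, s))) → 0` as `r → 0+` for every aperture
  `s > 0`, where `𝐁(a,r) ∖ (a + K(W, s)) = {x : ‖x − a‖ ≤ r, s‖x − a‖ ≤ ‖P_{W^⊥}(x − a)‖}` is the part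
  of the ball far from the plane,

*then `σ` is carried by a Borel countably `(k+1)`-rectifiable set.*

Proof ([Maggi2012, pp. 100–101]): the good points are covered by countably many *uniform classes*
`A` (lower density constant `≥ 1/(j+1)`, cone smallness `≤ η_j r^{k+1}` below the scale
`1/(m+1)`, plane `W_a` within `1/8` of the `i`-th plane of a countable dense family of planes,
`a` within `1/(4(m+1))` of the `q`-th point of a dense sequence). Two points `a ≠ b` of one class
satisfy `‖P_{W_a^⊥}(b − a)‖ < (3/8)‖b − a‖` (`norm_apply_sub_lt_of_density`: otherwise the ball
`𝐁(b, ‖b−a‖/8)` lies in the far cone of `a` at scale `2‖b − a‖` (`closedBall_subset_cone`), and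
the lower density bound at `b` contradicts the cone smallness at `a`), hence
`‖P_{W_i^⊥}(b − a)‖ ≤ ‖b − a‖/2`; so the orthogonal projection onto `W_i` is injective on the class
with `2`-Lipschitz inverse, and the class is a Lipschitz image of a subset of `W_i ≅ ℝ^{k+1}`
(`isCountablyRectifiable_of_norm_starProjection_sub_le`, [Maggi2012, Prop. 10.9]).

* `closedBall_subset_cone`, `norm_apply_sub_lt_of_density` — the two-point lemma;
* `isCountablyRectifiable_of_norm_starProjection_sub_le` — the Lipschitz-graph criterion;
* `exists_seq_planes_dense` — a countable family of `(k+1)`-planes dense for `‖P_{W^⊥} − P_{W'^⊥}‖`;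
* `IsCountablyRectifiable.exists_measurableSet_superset` — Borel hulls of countably rectifiable
  sets;
* **`exists_isCountablyRectifiable_of_coneDensity`** — the criterion.

## References

* F. Maggi, *Sets of Finite Perimeter and Geometric Variational Problems*, CUP 2012, Thm. 10.8
  and its proof (Step one), Prop. 10.9, pp. 99–101 (held copy
  `lit book:maggind-sets-finite-perimeter-geometric-variational-problems`) [Maggi2012].
* P. Mattila, *Geometry of Sets and Measures in Euclidean Spaces*, CUP 1995, 15.19 [Mattila1995].
* B. White, *A new proof of the compactness theorem for integral currents*, Comment. Math. Helv.
  64 (1989) 207–220, Step 4 [White1989].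
* L. Bandara, *The closure theorem for integral currents without the structure theorem*,
  B.Sc. thesis, ANU 2006, proof of Thm. 4.2.1, p. 45 (held copy
  `lit paper:galaxy-pdf-8023002039701172160`) [Bandara2006].
-/

noncomputable section

open scoped ENNReal NNReal Topology
open MeasureTheory TopologicalSpace Set Filter Metric Function

namespace Literature.Geometry.GeometricMeasureTheory

variable {V : Type*} [NormedAddCommGroup V] [InnerProductSpace ℝ V] [FiniteDimensional ℝ V]
  [MeasurableSpace V] [BorelSpace V] {k : ℕ}

/-! ### The two-point lemma -/

section TwoPoint

omit [FiniteDimensional ℝ V] [MeasurableSpace V] [BorelSpace V] in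
/-- **Geometry of the two-point lemma**: if `b − a` is far from the kernel direction of `Q`
(`‖Q(b − a)‖ ≥ 3s‖b − a‖`, `Q` norm-nonincreasing, `0 ≤ s ≤ 1`), then the whole ball
`𝐁(b, s‖b − a‖)` lies in the far cone `{x : ‖x − a‖ ≤ 2‖b − a‖, s‖x − a‖ ≤ ‖Q(x − a)‖}` of `a`.
[cite: Maggi2012, proof of Thm. 10.8, (10.18)] -/
theorem closedBall_subset_cone (Q : V →L[ℝ] V) (hQ : ∀ v, ‖Q v‖ ≤ ‖v‖) {a b : V} {s : ℝ}
    (hs0 : 0 ≤ s) (hs1 : s ≤ 1) (hfar : 3 * s * ‖b - a‖ ≤ ‖Q (b - a)‖) :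
    closedBall b (s * ‖b - a‖) ⊆ {x | ‖x - a‖ ≤ 2 * ‖b - a‖ ∧ s * ‖x - a‖ ≤ ‖Q (x - a)‖} := by
  intro x hx
  rw [mem_closedBall, dist_eq_norm] at hx
  have hρ0 : 0 ≤ ‖b - a‖ := norm_nonneg _
  have h1 : ‖x - a‖ ≤ ‖x - b‖ + ‖b - a‖ := by
    calc ‖x - a‖ = ‖(x - b) + (b - a)‖ := by rw [sub_add_sub_cancel]
      _ ≤ ‖x - b‖ + ‖b - a‖ := norm_add_le _ _
  have h1' : ‖x - a‖ ≤ s * ‖b - a‖ + ‖b - a‖ := h1.trans (by linarith)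
  refine ⟨h1'.trans (by nlinarith), ?_⟩
  have h2 : ‖Q (b - a)‖ ≤ ‖Q (x - a)‖ + ‖Q (x - b)‖ := by
    have : Q (b - a) = Q (x - a) - Q (x - b) := by
      rw [← map_sub]; congr 1; abel
    rw [this]
    exact norm_sub_le _ _
  have h3 : ‖Q (x - b)‖ ≤ s * ‖b - a‖ := (hQ _).trans hx
  have h4 : s * ‖x - a‖ ≤ s * (s * ‖b - a‖ + ‖b - a‖) := mul_le_mul_of_nonneg_left h1' hs0
  have h5 : s * (s * ‖b - a‖) ≤ 1 * (s * ‖b - a‖) :=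
    mul_le_mul_of_nonneg_right hs1 (mul_nonneg hs0 hρ0)
  linarith [h2, h3, h4, h5, hfar]

omit [FiniteDimensional ℝ V] [BorelSpace V] in
/-- **The two-point lemma** ([Maggi2012, (10.24)]): let `a ≠ b`, `0 < s ≤ 1`, `Q`
norm-nonincreasing, and suppose the lower density bound `c (s‖b−a‖)^{k+1} ≤ σ(𝐁(b, s‖b−a‖))` at `b`
and the cone smallness `σ(far cone of a at scale 2‖b−a‖) ≤ η (2‖b−a‖)^{k+1}` at `a`, with
`η 2^{k+2} ≤ c s^{k+1}` (`0 < c < ∞`). Then `‖Q(b − a)‖ < 3s‖b − a‖`.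
[cite: Maggi2012, proof of Thm. 10.8, Step one] -/
theorem norm_apply_sub_lt_of_density (σ : Measure V) (Q : V →L[ℝ] V) (hQ : ∀ v, ‖Q v‖ ≤ ‖v‖)
    {a b : V} (hab : a ≠ b) {s : ℝ} (hs0 : 0 < s) (hs1 : s ≤ 1) {c η : ℝ≥0∞} (hc0 : c ≠ 0)
    (hcT : c ≠ ⊤) (hη : η * 2 ^ (k + 2) ≤ c * ENNReal.ofReal (s ^ (k + 1)))
    (hlow : c * ENNReal.ofReal ((s * ‖b - a‖) ^ (k + 1)) ≤ σ (closedBall b (s * ‖b - a‖)))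
    (hcone : σ {x | ‖x - a‖ ≤ 2 * ‖b - a‖ ∧ s * ‖x - a‖ ≤ ‖Q (x - a)‖} ≤
      η * ENNReal.ofReal ((2 * ‖b - a‖) ^ (k + 1))) :
    ‖Q (b - a)‖ < 3 * s * ‖b - a‖ := by
  by_contra hfar
  rw [not_lt] at hfar
  have hρ : 0 < ‖b - a‖ := norm_pos_iff.2 (sub_ne_zero.2 (Ne.symm hab))
  set X : ℝ≥0∞ := ENNReal.ofReal (‖b - a‖ ^ (k + 1)) with hX
  have hX0 : X ≠ 0 := (ENNReal.ofReal_pos.2 (by positivity)).ne'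
  have hXT : X ≠ ⊤ := ENNReal.ofReal_ne_top
  have hsub := closedBall_subset_cone Q hQ hs0.le hs1 hfar
  have h1 : c * ENNReal.ofReal (s ^ (k + 1)) * X ≤ η * 2 ^ (k + 1) * X := by
    have e1 : ENNReal.ofReal ((s * ‖b - a‖) ^ (k + 1)) = ENNReal.ofReal (s ^ (k + 1)) * X := by
      rw [hX, mul_pow, ENNReal.ofReal_mul (by positivity)]
    have e2 : ENNReal.ofReal ((2 * ‖b - a‖) ^ (k + 1)) = 2 ^ (k + 1) * X := by
      rw [hX, mul_pow, ENNReal.ofReal_mul (by positivity), ENNReal.ofReal_pow zero_le_two,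
        ENNReal.ofReal_ofNat]
    calc c * ENNReal.ofReal (s ^ (k + 1)) * X = c * ENNReal.ofReal ((s * ‖b - a‖) ^ (k + 1)) := by
          rw [e1, mul_assoc]
      _ ≤ σ (closedBall b (s * ‖b - a‖)) := hlow
      _ ≤ σ {x | ‖x - a‖ ≤ 2 * ‖b - a‖ ∧ s * ‖x - a‖ ≤ ‖Q (x - a)‖} := measure_mono hsub
      _ ≤ η * ENNReal.ofReal ((2 * ‖b - a‖) ^ (k + 1)) := hcone
      _ = η * 2 ^ (k + 1) * X := by rw [e2, mul_assoc]
  set Y : ℝ≥0∞ := c * ENNReal.ofReal (s ^ (k + 1)) * X with hY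
  have hY0 : Y ≠ 0 := mul_ne_zero (mul_ne_zero hc0 (ENNReal.ofReal_pos.2 (by positivity)).ne') hX0
  have hYT : Y ≠ ⊤ := ENNReal.mul_ne_top (ENNReal.mul_ne_top hcT ENNReal.ofReal_ne_top) hXT
  have h2 : 2 * Y ≤ Y := by
    calc 2 * Y = 2 * (c * ENNReal.ofReal (s ^ (k + 1)) * X) := rfl
      _ ≤ 2 * (η * 2 ^ (k + 1) * X) := by gcongr
      _ = η * 2 ^ (k + 2) * X := by ring
      _ ≤ c * ENNReal.ofReal (s ^ (k + 1)) * X := by gcongr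
  have h3 : Y + Y ≤ Y + 0 := by
    rw [add_zero]
    rwa [two_mul] at h2
  exact hY0 (nonpos_iff_eq_zero.1 ((ENNReal.add_le_add_iff_left hYT).1 h3))

end TwoPoint

/-! ### The Lipschitz-graph criterion -/

section Graph

/-- **Rectifiability criterion (Lipschitz graph over a plane)**: if `‖P_{W^⊥}(b − a)‖ ≤ ‖b − a‖/2`
for all `a, b ∈ A`, `W` a `(k+1)`-plane, then the orthogonal projection onto `W` is injective on
`A` with `2`-Lipschitz inverse, so `A` is a Lipschitz image of a subset of `W ≅ ℝ^{k+1}` and hence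
countably `(k+1)`-rectifiable. [cite: Maggi2012, Prop. 10.9] -/
theorem isCountablyRectifiable_of_norm_starProjection_sub_le (W : Submodule ℝ V)
    (hdim : Module.finrank ℝ W = k + 1) {A : Set V}
    (hA : ∀ a ∈ A, ∀ b ∈ A, ‖Wᗮ.starProjection (b - a)‖ ≤ ‖b - a‖ / 2) :
    IsCountablyRectifiable (k + 1) A := by
  classical
  set P := W.orthogonalProjectionOnto with hPdef
  -- `‖b - a‖ ≤ 2 ‖P b - P a‖` on `A`
  have hco : ∀ a ∈ A, ∀ b ∈ A, ‖b - a‖ ≤ 2 * ‖P b - P a‖ := by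
    intro a ha b hb
    have hsum : ‖b - a‖ ≤ ‖P (b - a)‖ + ‖Wᗮ.starProjection (b - a)‖ := by
      calc ‖b - a‖ = ‖W.starProjection (b - a) + Wᗮ.starProjection (b - a)‖ := by
            rw [Submodule.starProjection_add_starProjection_orthogonal]
        _ ≤ ‖W.starProjection (b - a)‖ + ‖Wᗮ.starProjection (b - a)‖ := norm_add_le _ _
        _ = ‖P (b - a)‖ + ‖Wᗮ.starProjection (b - a)‖ := by
            rw [Submodule.starProjection_apply, Submodule.norm_coe]
    have := hA a ha b hb
    rw [map_sub] at hsum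
    linarith
  have hinj : InjOn P A := by
    intro a ha b hb hPab
    have h := hco a ha b hb
    rw [hPab, sub_self, norm_zero, mul_zero] at h
    exact (sub_eq_zero.1 (norm_le_zero_iff.1 h)).symm
  rcases isEmpty_or_nonempty V with hV | hV
  · exact IsCountablyRectifiable.of_measure_zero (by rw [Set.eq_empty_of_isEmpty A, measure_empty])
  set F : W → V := invFunOn P A with hFdef
  have hFP : ∀ a ∈ A, F (P a) = a := fun a ha => hinj.leftInvOn_invFunOn ha
  have hlip : LipschitzOnWith 2 F (P '' A) := by
    refine LipschitzOnWith.of_dist_le_mul fun w hw w' hw' => ?_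
    obtain ⟨a, ha, rfl⟩ := hw
    obtain ⟨b, hb, rfl⟩ := hw'
    rw [hFP a ha, hFP b hb, dist_eq_norm, dist_eq_norm, NNReal.coe_ofNat]
    simpa only [norm_sub_rev] using hco b hb a ha
  have hsub : A ⊆ F '' (P '' A) := fun a ha => ⟨P a, mem_image_of_mem P ha, hFP a ha⟩
  set e : OrthonormalBasis (Fin (k + 1)) ℝ W := (stdOrthonormalBasis ℝ W).reindex (finCongr hdim)
  exact isCountablyRectifiable_of_subset_image_lipschitzOnWith' e hlip hsub

end Graph

/-! ### A countable dense family of planes -/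

section Planes

omit [MeasurableSpace V] [BorelSpace V] in
/-- **A countable family of `(k+1)`-planes, dense for the distance `‖P_{W^⊥} − P_{W'^⊥}‖`** (the
Grassmannian is a subset of the separable space of endomorphisms of `V`; [Maggi2012, (10.19)]
uses a finite family by compactness). [cite: Maggi2012, proof of Thm. 10.8, (10.19)] -/
theorem exists_seq_planes_dense (hex : ∃ W : Submodule ℝ V, Module.finrank ℝ W = k + 1) :
    ∃ Wseq : ℕ → Submodule ℝ V, (∀ i, Module.finrank ℝ (Wseq i) = k + 1) ∧
      ∀ W : Submodule ℝ V, Module.finrank ℝ W = k + 1 → ∀ δ : ℝ, 0 < δ →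
        ∃ i, ‖Wᗮ.starProjection - (Wseq i)ᗮ.starProjection‖ < δ := by
  classical
  set S : Set (V →L[ℝ] V) :=
    {Q | ∃ W : Submodule ℝ V, Module.finrank ℝ W = k + 1 ∧ Wᗮ.starProjection = Q} with hS
  have hsep : IsSeparable S := IsSeparable.of_separableSpace S
  obtain ⟨t, htS, htc, hSt⟩ := hsep.exists_countable_dense_subset
  obtain ⟨W₀, hW₀⟩ := hex
  have htne : t.Nonempty := by
    by_contra h
    rw [not_nonempty_iff_eq_empty] at h
    have : (W₀ᗮ.starProjection : V →L[ℝ] V) ∈ closure t := hSt ⟨W₀, hW₀, rfl⟩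
    rw [h, closure_empty] at this
    exact this
  obtain ⟨Qs, hQs⟩ := htc.exists_eq_range htne
  have hmem : ∀ i, Qs i ∈ S := fun i => htS (hQs ▸ mem_range_self i)
  choose Wseq hWdim hWQ using hmem
  refine ⟨Wseq, hWdim, fun W hW δ hδ => ?_⟩
  have hcl : (Wᗮ.starProjection : V →L[ℝ] V) ∈ closure t := hSt ⟨W, hW, rfl⟩
  obtain ⟨Q, hQt, hQd⟩ := Metric.mem_closure_iff.1 hcl δ hδ
  rw [hQs] at hQt
  obtain ⟨i, rfl⟩ := hQt
  refine ⟨i, ?_⟩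
  rwa [hWQ i, ← dist_eq_norm]

end Planes

/-! ### Borel hulls of countably rectifiable sets -/

section Hull

omit [InnerProductSpace ℝ V] [FiniteDimensional ℝ V] in
/-- A countably `m`-rectifiable set is contained in a BOREL countably `m`-rectifiable set (the
union of the Lipschitz images, which are σ-compact, and a Borel `𝓗^m`-null hull of the rest).
[cite: Federer1969, 3.2.14] -/
theorem IsCountablyRectifiable.exists_measurableSet_superset {m : ℕ} {M : Set V}
    (hM : IsCountablyRectifiable m M) :
    ∃ M' : Set V, M ⊆ M' ∧ MeasurableSet M' ∧ IsCountablyRectifiable m M' := by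
  obtain ⟨f, hf, h0⟩ := hM
  set R : Set V := ⋃ i, range (f i) with hR
  have hRm : MeasurableSet R := by
    refine MeasurableSet.iUnion fun i => ?_
    obtain ⟨K, hK⟩ := hf i
    obtain ⟨C, hC, hCU⟩ := isSigmaCompact_range hK.continuous
    rw [← hCU]
    exact MeasurableSet.iUnion fun n => (hC n).measurableSet
  refine ⟨R ∪ toMeasurable (μHE[m] : Measure V) (M \ R), fun x hx => ?_,
    hRm.union (measurableSet_toMeasurable _ _), ⟨f, hf, ?_⟩⟩
  · by_cases hxR : x ∈ R
    · exact Or.inl hxR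
    · exact Or.inr (subset_toMeasurable _ _ ⟨hx, hxR⟩)
  · have hsub : (R ∪ toMeasurable (μHE[m] : Measure V) (M \ R)) \ R ⊆
        toMeasurable (μHE[m] : Measure V) (M \ R) := fun x hx => hx.1.resolve_left hx.2
    exact measure_mono_null hsub ((measure_toMeasurable _).trans h0)

end Hull

/-! ### The criterion -/

section Criterion

/-- **Rectifiability from positive lower density and the cone property**
([Maggi2012, Thm. 10.8, Step one; Mattila1995, 15.19]): let `σ` be a measure on `V` such that for
`σ`-a.e. `a` there are a `(k+1)`-plane `W` and `c > 0` with `c r^{k+1} ≤ σ(𝐁(a, r))` for all small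
`r > 0`, and `r^{-(k+1)} σ{x : ‖x − a‖ ≤ r, s‖x − a‖ ≤ ‖P_{W^⊥}(x − a)‖} → 0` as `r → 0+` for every
`s > 0`. Then `σ` is carried by a Borel countably `(k+1)`-rectifiable set: there is a measurable,
countably `(k+1)`-rectifiable `M₁` with `σ(V ∖ M₁) = 0`.
[cite: Maggi2012, Thm. 10.8 and Prop. 10.9; White1989, p. 220] -/
theorem exists_isCountablyRectifiable_of_coneDensity (σ : Measure V)
    (h : ∀ᵐ a ∂σ, ∃ W : Submodule ℝ V, Module.finrank ℝ W = k + 1 ∧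
      (∃ c : ℝ≥0∞, c ≠ 0 ∧
        ∀ᶠ r in 𝓝[>] (0 : ℝ), c * ENNReal.ofReal (r ^ (k + 1)) ≤ σ (closedBall a r)) ∧
      ∀ s : ℝ, 0 < s → Tendsto (fun r : ℝ => ENNReal.ofReal ((r⁻¹) ^ (k + 1)) *
        σ {x | ‖x - a‖ ≤ r ∧ s * ‖x - a‖ ≤ ‖Wᗮ.starProjection (x - a)‖}) (𝓝[>] 0) (𝓝 0)) :
    ∃ M₁ : Set V, MeasurableSet M₁ ∧ IsCountablyRectifiable (k + 1) M₁ ∧ σ M₁ᶜ = 0 := by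
  classical
  -- it suffices to find a countably rectifiable carrier (then take a Borel hull)
  suffices H : ∃ M₀ : Set V, IsCountablyRectifiable (k + 1) M₀ ∧ σ M₀ᶜ = 0 by
    obtain ⟨M₀, hM₀, hσ⟩ := H
    obtain ⟨M₁, hsub, hM₁m, hM₁⟩ := hM₀.exists_measurableSet_superset
    exact ⟨M₁, hM₁m, hM₁, measure_mono_null (compl_subset_compl.2 hsub) hσ⟩
  -- the good set
  set G : Set V := {a | ∃ W : Submodule ℝ V, Module.finrank ℝ W = k + 1 ∧
      (∃ c : ℝ≥0∞, c ≠ 0 ∧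
        ∀ᶠ r in 𝓝[>] (0 : ℝ), c * ENNReal.ofReal (r ^ (k + 1)) ≤ σ (closedBall a r)) ∧
      ∀ s : ℝ, 0 < s → Tendsto (fun r : ℝ => ENNReal.ofReal ((r⁻¹) ^ (k + 1)) *
        σ {x | ‖x - a‖ ≤ r ∧ s * ‖x - a‖ ≤ ‖Wᗮ.starProjection (x - a)‖}) (𝓝[>] 0) (𝓝 0)}
    with hGdef
  have hG : σ Gᶜ = 0 := by
    rw [ae_iff] at h
    simpa only [hGdef, compl_setOf] using h
  -- no `(k+1)`-planes: nothing to prove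
  by_cases hex : ∃ W : Submodule ℝ V, Module.finrank ℝ W = k + 1
  swap
  · refine ⟨∅, isCountablyRectifiable_empty, measure_mono_null (fun a _ => ?_) hG⟩
    rintro ⟨W, hW, -⟩
    exact hex ⟨W, hW⟩
  obtain ⟨Wseq, hWdim, hWdense⟩ := exists_seq_planes_dense hex
  obtain ⟨W₀, -⟩ := hex
  haveI : Nonempty V := ⟨0⟩
  obtain ⟨u, hu⟩ := exists_dense_seq V
  -- constants
  set s : ℝ := 1 / 8 with hs
  have hs0 : 0 < s := by norm_num [hs]
  have hs1 : s ≤ 1 := by norm_num [hs]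
  set cJ : ℕ → ℝ≥0∞ := fun j => ((j : ℝ≥0∞) + 1)⁻¹ with hcJ
  have hcJ0 : ∀ j, cJ j ≠ 0 := fun j => ENNReal.inv_ne_zero.2 (by simp)
  have hcJT : ∀ j, cJ j ≠ ⊤ := fun j => ENNReal.inv_ne_top.2 (by simp)
  set ηJ : ℕ → ℝ≥0∞ := fun j => cJ j * ENNReal.ofReal (s ^ (k + 1)) / 2 ^ (k + 2) with hηJ
  have h2pow0 : (2 : ℝ≥0∞) ^ (k + 2) ≠ 0 := pow_ne_zero _ two_ne_zero
  have h2powT : (2 : ℝ≥0∞) ^ (k + 2) ≠ ⊤ := ENNReal.pow_ne_top ENNReal.ofNat_ne_top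
  have hηJ0 : ∀ j, ηJ j ≠ 0 := fun j =>
    (ENNReal.div_pos_iff.2 ⟨mul_ne_zero (hcJ0 j) (ENNReal.ofReal_pos.2 (by positivity)).ne',
      h2powT⟩).ne'
  have hηJc : ∀ j, ηJ j * 2 ^ (k + 2) ≤ cJ j * ENNReal.ofReal (s ^ (k + 1)) := fun j =>
    (ENNReal.div_mul_cancel h2pow0 h2powT).le
  set rM : ℕ → ℝ := fun m => 1 / ((m : ℝ) + 1) with hrM
  have hrM0 : ∀ m, 0 < rM m := fun m => by simp only [hrM]; positivity
  -- the uniform classes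
  set A : ℕ → ℕ → ℕ → ℕ → Set V := fun j m i q =>
    {a | dist a (u q) ≤ rM m / 4 ∧ ∃ W : Submodule ℝ V, Module.finrank ℝ W = k + 1 ∧
      ‖Wᗮ.starProjection - (Wseq i)ᗮ.starProjection‖ ≤ s ∧
      (∀ r : ℝ, 0 < r → r ≤ rM m → cJ j * ENNReal.ofReal (r ^ (k + 1)) ≤ σ (closedBall a r)) ∧
      (∀ r : ℝ, 0 < r → r ≤ rM m →
        σ {x | ‖x - a‖ ≤ r ∧ s * ‖x - a‖ ≤ ‖Wᗮ.starProjection (x - a)‖} ≤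
          ηJ j * ENNReal.ofReal (r ^ (k + 1)))} with hA
  -- (i) each class is countably rectifiable (two-point lemma + Lipschitz graph)
  have hpiece : ∀ j m i q, IsCountablyRectifiable (k + 1) (A j m i q) := by
    intro j m i q
    refine isCountablyRectifiable_of_norm_starProjection_sub_le (Wseq i) (hWdim i) ?_
    intro a ha b hb
    rcases eq_or_ne a b with rfl | hab
    · simp
    obtain ⟨haq, Wa, -, hWai, -, hacone⟩ := ha
    obtain ⟨hbq, Wb, -, -, hblow, -⟩ := hb
    have hρ : 0 < ‖b - a‖ := norm_pos_iff.2 (sub_ne_zero.2 (Ne.symm hab))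
    have hρle : ‖b - a‖ ≤ rM m / 2 := by
      rw [← dist_eq_norm]
      linarith [dist_triangle_right b a (u q)]
    -- two-point lemma with `a`'s own plane
    have hlt : ‖Waᗮ.starProjection (b - a)‖ < 3 * s * ‖b - a‖ :=
      norm_apply_sub_lt_of_density σ (Waᗮ.starProjection) (fun v => Waᗮ.norm_starProjection_apply_le v)
        hab hs0 hs1 (hcJ0 j) (hcJT j) (hηJc j)
        (hblow _ (by positivity) (by nlinarith))
        (hacone _ (by positivity) (by linarith))
    -- pass to the `i`-th plane
    have hdiff : ‖(Wseq i)ᗮ.starProjection (b - a) - Waᗮ.starProjection (b - a)‖ ≤ s * ‖b - a‖ := by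
      have e : (Wseq i)ᗮ.starProjection (b - a) - Waᗮ.starProjection (b - a) =
          ((Wseq i)ᗮ.starProjection - Waᗮ.starProjection) (b - a) := rfl
      rw [e]
      refine (((Wseq i)ᗮ.starProjection - Waᗮ.starProjection).le_opNorm _).trans ?_
      rw [norm_sub_rev ((Wseq i)ᗮ.starProjection)]
      exact mul_le_mul_of_nonneg_right hWai hρ.le
    calc ‖(Wseq i)ᗮ.starProjection (b - a)‖
        ≤ ‖Waᗮ.starProjection (b - a)‖ +
            ‖(Wseq i)ᗮ.starProjection (b - a) - Waᗮ.starProjection (b - a)‖ :=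
          norm_le_norm_add_norm_sub' _ _
      _ ≤ 3 * s * ‖b - a‖ + s * ‖b - a‖ := add_le_add hlt.le hdiff
      _ = ‖b - a‖ / 2 := by rw [hs]; ring
  -- (ii) the classes cover the good set
  have hcover : G ⊆ ⋃ j, ⋃ m, ⋃ i, ⋃ q, A j m i q := by
    intro a ha
    obtain ⟨W, hW, ⟨c, hc0, hlow⟩, hcone⟩ := ha
    -- `j`: `1/(j+1) ≤ c`
    obtain ⟨j, hj⟩ := ENNReal.exists_inv_nat_lt hc0
    have hcj : cJ j ≤ c := by
      refine le_trans ?_ hj.le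
      exact ENNReal.inv_le_inv.2 (by simp)
    -- `m`: the scale below which both bounds hold
    have hev : ∀ᶠ r in 𝓝[>] (0 : ℝ), c * ENNReal.ofReal (r ^ (k + 1)) ≤ σ (closedBall a r) ∧
        ENNReal.ofReal ((r⁻¹) ^ (k + 1)) *
          σ {x | ‖x - a‖ ≤ r ∧ s * ‖x - a‖ ≤ ‖Wᗮ.starProjection (x - a)‖} < ηJ j :=
      hlow.and ((hcone s hs0).eventually (gt_mem_nhds (hηJ0 j).bot_lt))
    obtain ⟨u', hu'0, hu'⟩ := mem_nhdsGT_iff_exists_Ioo_subset.1 hev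
    rw [mem_Ioi] at hu'0
    obtain ⟨m, hm⟩ := exists_nat_one_div_lt hu'0
    -- `i`: a nearby plane of the family; `q`: a nearby centre
    obtain ⟨i, hi⟩ := hWdense W hW s hs0
    obtain ⟨q, hq⟩ := hu.exists_dist_lt a (by positivity : 0 < rM m / 4)
    refine mem_iUnion.2 ⟨j, mem_iUnion.2 ⟨m, mem_iUnion.2 ⟨i, mem_iUnion.2 ⟨q, hq.le, W, hW, hi.le,
      fun r hr hrm => ?_, fun r hr hrm => ?_⟩⟩⟩⟩
    · have hr' := (hu' ⟨hr, lt_of_le_of_lt hrm hm⟩).1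
      calc cJ j * ENNReal.ofReal (r ^ (k + 1)) ≤ c * ENNReal.ofReal (r ^ (k + 1)) := by gcongr
        _ ≤ σ (closedBall a r) := hr'
    · have hr' := (hu' ⟨hr, lt_of_le_of_lt hrm hm⟩).2
      have e1 : σ {x | ‖x - a‖ ≤ r ∧ s * ‖x - a‖ ≤ ‖Wᗮ.starProjection (x - a)‖} =
          ENNReal.ofReal (r ^ (k + 1)) * (ENNReal.ofReal ((r⁻¹) ^ (k + 1)) *
            σ {x | ‖x - a‖ ≤ r ∧ s * ‖x - a‖ ≤ ‖Wᗮ.starProjection (x - a)‖}) := by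
        rw [← mul_assoc, ← ENNReal.ofReal_mul (by positivity), ← mul_pow,
          mul_inv_cancel₀ hr.ne', one_pow, ENNReal.ofReal_one, one_mul]
      rw [e1, mul_comm (ηJ j)]
      gcongr
  refine ⟨⋃ j, ⋃ m, ⋃ i, ⋃ q, A j m i q, ?_, measure_mono_null (compl_subset_compl.2 hcover) hG⟩
  exact IsCountablyRectifiable.iUnion fun j => IsCountablyRectifiable.iUnion fun m =>
    IsCountablyRectifiable.iUnion fun i => IsCountablyRectifiable.iUnion fun q => hpiece j m i q

end Criterion

end Literature.Geometry.GeometricMeasureTheory
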